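import Mathlib
import Summits.NavierStokesRegularity.NavierStokesRegularity.Theses.ConeTipCollapse
import Summits.NavierStokesRegularity.NavierStokesRegularity.Theorems.AdiabaticEddyClayUniquenessCore
import HarnessLib

/-!
# Route ConeTipCollapse — support item `ClayUniqueness` PROVED (stmt-NavierStokesRegularity-19065;
  shared verbatim with `RotatingEulerWindowProfile.BlowupClayUniqueness`)

The item is the tree's Clay-class weak–strong uniqueness theorem
`Theorems.blowup_clay_uniqueness` (stmt-NavierStokesRegularity-0153, Blowup.X5b /
AdiabaticEddy.ClayUniqueness) stated verbatim: a Fefferman class-(A) solution from a rapidly decaying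
datum agrees on `[0, T)` with any classical Leray–Hopf solution from the same datum. One-line
closure by name.

HONEST FRAMING: bookkeeping (a binder of the route's `closes`); nothing here bears on the regularity
question itself. Lands `--workitem stmt-NavierStokesRegularity-19065` (typer seat g19 of cell
pub-ns-dss, idle-row item).
-/

namespace Summit.NavierStokesRegularity.NavierStokesRegularity.Theorems

set_option linter.dupNamespace false

/-- **`ClayUniqueness` (stmt-NavierStokesRegularity-19065)** = the landed `blowup_clay_uniqueness`
(weak–strong uniqueness in the Clay class, Robinson–Rodrigo–Sadowski 2016 Thm 6.10 / Tao 2013), by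
name. [this file] -/
theorem coneTipCollapse_clayUniqueness_proof : Theses.ConeTipCollapse.ClayUniqueness :=
  blowup_clay_uniqueness

end Summit.NavierStokesRegularity.NavierStokesRegularity.Theorems
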